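import Summits.ABC.IUTFork.Repair.RHSigmaCellCredit
import Summits.ABC.IUTFork.Repair.RHSigmaLicenceInvariance
import HarnessLib

/-!
# R-H ROUND 3 (generic): THE EXACT-SLACK CEILING of every SOUND cell-level law — `D ≤ R_∅ ≤ PN Σᶠ (1−ω)·t` for every weight `ω ≤ 1` satisfying [PC],
# with EQUALITY for the optimal law `ω⋆ = 1 − d⁺/t`; hence no partial-credit device at the typed hull charges less than the total positive deficit

abc-iut cell, rung LADDER-ABC:A2.RESCUE.H, R-H seat abc-iut-rh2-q2-eq (gen 3). PROOF-ONLY sequel (0 definitions, 0 `Prop` facts, no instance, no notation) of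
this seat's `RHSigmaCellCredit.lean` (p484504, THE PARTIAL-CREDIT DOOR `statementUpTo_weightedTrivialMass_of_cellCredit`) and `RHSigmaLicenceInvariance.lean`
(p476178, `offRemainder_empty_eq`: `R_∅ = PN Σᶠ (cellDeficit)⁺`). It is the kernel form of the «L1 EXACT-SLACK CEILING» socket of rh4-ref-1's GRADING-R3
v0 §3 (rh-lead R20, 2026-08-27: «L1 exact-slack ceiling ⇒ μ′ ≤ μ_ex»): whatever CELL-LEVEL law [PC] «`d(c) ≤ (1 − ω(c))·t(c)`» a round-3 object
certifies about OUR typed hull, if it is TRUE and `ω ≤ 1`, the mass it charges is at least the total positive deficit `R_∅` — its kept fraction `μ′`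
is at most `μ_ex := 1 − R_∅/M` — and the bound is attained.

WHAT IS PROVED (generic: ANY `P : Cor312.Setting S` under the bridge hypotheses; `d = cellDeficit`, `t = cellTrivialCost ≥ 0`, `M = totalTrivialMass`,
`R_∅ = offRemainder P ∅`, `D = signedRemainder`):
* §1 `posDeficit_le_of_cellCredit` — cellwise: `ω(c) ≤ 1` and [PC] at `c` give `d(c)⁺ ≤ (1 − ω(c))·t(c)`.
  **`offRemainder_empty_le_weightedTrivialMass_of_cellCredit`** — THE CEILING: `ω ≤ 1` ∧ [PC] ⟹ `R_∅ ≤ weightedTrivialMass P ω`; with p479556/p480491: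
  `D ≤ R_∅ ≤ PN Σᶠ (1−ω)·t` (`signedRemainder_le_weightedTrivialMass_of_cellCredit`); kept-mass form **`keptMass_le_totalTrivialMass_sub_offRemainder_empty`**
  (`PN Σᶠ ω·t ≤ M − R_∅`, i.e. `μ′·M ≤ μ_ex·M`); tolerance form `offRemainder_empty_le_of_cellCredit_of_le` (a sound law meeting ANY budget
  `PN Σᶠ (1−ω)·t ≤ B` forces `R_∅ ≤ B` — in particular the exponent programme's [MU-ω] ⟹ [MU] on `R_∅`, `…_le_mul_add_of_cellCredit`).
* §2 **`exists_cellCredit_weightedTrivialMass_eq_offRemainder_empty`** — OPTIMALITY: the law `ω⋆(c) := 1 − d(c)⁺/t(c)` (`:= 1` where `t(c) = 0`) satisfies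
  `0 ≤ ω⋆ ≤ 1`, [PC], and `weightedTrivialMass P ω⋆ = R_∅`: the ceiling is attained, so «cellwise partial credit» as a class reaches EXACTLY the R_∅-currency
  ends of record (this seat's p477420 / p478948 …) and never the signed floor `D = R_∅ − C` (credits are not netted cell by cell; netting is THE WEIGHTED
  DOOR's aggregate hypothesis, whose floor is `D`, p480491 `signedRemainder_le_weightedDeficit_add_weightedTrivialMass`).
READING (round 3): a candidate's cell-level law about the typed hull can lower the CHARGED mass only down to `R_∅(T)`; any `μ′ > μ_ex(T)` claimed for such a
law certifies a FALSE [PC] instance (test: L1). New mass beyond `μ_ex` needs a new container / new upper-bound input, which moves `−|log(Θ)|` by the same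
amount (`RHSigmaLicenceSigned.avg_cellDeficit_eq`: `D = −|log(q)| − PN Σᶠ logvol(ⁿ˚𝒰)` — rh4-ref-1's L3 «socket conservation» in kernel).
HONEST FRAMING: inequalities about OUR typed objects; [PC] is an ASSUMPTION SHAPE; nothing here asserts that abc is proved or refuted, or that [IUTchIII]
Cor. 3.12 holds or fails at any datum, or takes a side on any author; typed ≠ proved. [claim: Mochizuki2012, status: disputed] for every IUT locution.
[cite: Mochizuki2012, IUTchIII Cor. 3.12 p. 173–174, Prop. 3.9 (i)(iii) p. 116] [cite: DupuyHilado2025, §3.9]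
-/

noncomputable section

open Set Function

namespace Summit.ABC.IUTFork.Repair.RH.SigmaLicence

open Summit.ABC.IUTFork.Thm311 Summit.ABC.IUTFork.Cor312 Summit.ABC.IUTFork.Cor312.Setting Summit.ABC.IUTFork.Cor312Vol
  Literature.IUT.LogThetaLattice Summit.ABC.IUTFork.Repair.RH.SigmaMass

variable {T : ThetaIndex} {S : Situation T} {P : Cor312.Setting S}

/-! ## §1. The ceiling: a sound cell-level law charges at least the total positive deficit -/

/-- Cellwise: `ω(c) ≤ 1` and [PC] `d(c) ≤ (1 − ω(c))·t(c)` give `d(c)⁺ ≤ (1 − ω(c))·t(c)` (`t ≥ 0`). [folklore] -/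
theorem posDeficit_le_of_cellCredit {ω : Fin T.lstar × T.VQ → ℝ} {c : Fin T.lstar × T.VQ} (hω : ω c ≤ 1)
    (h : cellDeficit P c.1 c.2 ≤ (1 - ω c) * cellTrivialCost P c) :
    max (cellDeficit P c.1 c.2) 0 ≤ (1 - ω c) * cellTrivialCost P c :=
  max_le h (mul_nonneg (by linarith) (cellTrivialCost_nonneg c))

/-- **THE EXACT-SLACK CEILING (GRADING-R3 L1 in kernel).** Under the bridge hypotheses, every weight `ω ≤ 1` satisfying the cell-level law [PC]
«`d(c) ≤ (1 − ω(c))·t(c)` at every cell» charges at least the total positive deficit: `R_∅ = offRemainder P ∅ ≤ weightedTrivialMass P ω`.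
[cite: Mochizuki2012, IUTchIII Cor. 3.12 p. 173–174] [claim: Mochizuki2012, status: disputed] -/
theorem offRemainder_empty_le_weightedTrivialMass_of_cellCredit (H : BridgeHyps P) {ω : Fin T.lstar × T.VQ → ℝ} (hω : ∀ c, ω c ≤ 1)
    (h : ∀ c : Fin T.lstar × T.VQ, cellDeficit P c.1 c.2 ≤ (1 - ω c) * cellTrivialCost P c) :
    offRemainder P ∅ ≤ weightedTrivialMass P ω := by
  rw [offRemainder_empty_eq]
  unfold weightedTrivialMass processionNormalized
  refine div_le_div_of_nonneg_right (Finset.sum_le_sum fun i _ => ?_) (Nat.cast_nonneg _)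
  exact finsum_le_finsum' (posDeficit_support_finite H i) (weightedTrivialMass_support_finite H ω i)
    fun vQ => posDeficit_le_of_cellCredit (hω (i, vQ)) (h (i, vQ))

/-- `D ≤ R_∅ ≤ PN Σᶠ (1−ω)·t`: the signed remainder below the ceiling (p480491 `signedRemainder_le_offRemainder_empty`). [claim: Mochizuki2012, status: disputed] -/
theorem signedRemainder_le_weightedTrivialMass_of_cellCredit (H : BridgeHyps P) {ω : Fin T.lstar × T.VQ → ℝ} (hω : ∀ c, ω c ≤ 1)
    (h : ∀ c : Fin T.lstar × T.VQ, cellDeficit P c.1 c.2 ≤ (1 - ω c) * cellTrivialCost P c) :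
    signedRemainder P ≤ weightedTrivialMass P ω :=
  (signedRemainder_le_offRemainder_empty H).trans (offRemainder_empty_le_weightedTrivialMass_of_cellCredit H hω h)

/-- **Kept-mass form of the ceiling: `PN Σᶠ ω·t ≤ M − R_∅`** — the kept fraction `μ′` of any sound cell-level law is at most `μ_ex = 1 − R_∅/M`.
[claim: Mochizuki2012, status: disputed] -/
theorem keptMass_le_totalTrivialMass_sub_offRemainder_empty (H : BridgeHyps P) {ω : Fin T.lstar × T.VQ → ℝ} (hω : ∀ c, ω c ≤ 1)
    (h : ∀ c : Fin T.lstar × T.VQ, cellDeficit P c.1 c.2 ≤ (1 - ω c) * cellTrivialCost P c) :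
    weightedTrivialMass P (fun c => 1 - ω c) ≤ totalTrivialMass P - offRemainder P ∅ := by
  have hc := offRemainder_empty_le_weightedTrivialMass_of_cellCredit H hω h
  have hs := weightedTrivialMass_add_compl H ω
  linarith

/-- Tolerance form: a sound law meeting a budget `PN Σᶠ (1−ω)·t ≤ B` forces `R_∅ ≤ B`. [claim: Mochizuki2012, status: disputed] -/
theorem offRemainder_empty_le_of_cellCredit_of_le (H : BridgeHyps P) {ω : Fin T.lstar × T.VQ → ℝ} (hω : ∀ c, ω c ≤ 1)
    (h : ∀ c : Fin T.lstar × T.VQ, cellDeficit P c.1 c.2 ≤ (1 - ω c) * cellTrivialCost P c) {B : ℝ}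
    (hB : weightedTrivialMass P ω ≤ B) : offRemainder P ∅ ≤ B :=
  (offRemainder_empty_le_weightedTrivialMass_of_cellCredit H hω h).trans hB

/-- The exponent programme's relative tolerance passes to `R_∅`: [MU-ω] «`PN Σᶠ (1−ω)·t ≤ κ·M + A`» for a sound `ω ≤ 1` ⟹ [MU] «`R_∅ ≤ κ·M + A`» — a
partial-credit end is never stronger than the `R_∅`-currency end with the same `(κ, A)`. [claim: Mochizuki2012, status: disputed] -/
theorem offRemainder_empty_le_mul_add_of_cellCredit (H : BridgeHyps P) {ω : Fin T.lstar × T.VQ → ℝ} (hω : ∀ c, ω c ≤ 1)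
    (h : ∀ c : Fin T.lstar × T.VQ, cellDeficit P c.1 c.2 ≤ (1 - ω c) * cellTrivialCost P c) {κ A : ℝ}
    (hMu : weightedTrivialMass P ω ≤ κ * totalTrivialMass P + A) : offRemainder P ∅ ≤ κ * totalTrivialMass P + A :=
  offRemainder_empty_le_of_cellCredit_of_le H hω h hMu

/-! ## §2. Optimality: the law `ω⋆ = 1 − d⁺/t` attains the ceiling -/

/-- The optimal cell-level law: full credit where the trivial cost vanishes, otherwise the exact unpaid fraction `1 − d⁺/t`. At every cell its charge
`(1 − ω⋆)·t` IS the positive deficit `d⁺`. [folklore] -/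
theorem optimalCredit_charge_eq (H : BridgeHyps P) (c : Fin T.lstar × T.VQ) :
    (1 - (if cellTrivialCost P c = 0 then (1 : ℝ) else 1 - max (cellDeficit P c.1 c.2) 0 / cellTrivialCost P c)) * cellTrivialCost P c =
      max (cellDeficit P c.1 c.2) 0 := by
  by_cases ht : cellTrivialCost P c = 0
  · rw [if_pos ht, ht, mul_zero]
    have hd : cellDeficit P c.1 c.2 ≤ 0 := (cellDeficit_le_cellTrivialCost H c).trans_eq ht
    exact (max_eq_right hd).symm
  · rw [if_neg ht, sub_sub_cancel, div_mul_cancel₀ _ ht]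

/-- **OPTIMALITY OF THE CEILING.** Under the bridge hypotheses there is a weight `ω⋆` with `0 ≤ ω⋆ ≤ 1`, satisfying [PC], whose charged mass is EXACTLY
the total positive deficit: `weightedTrivialMass P ω⋆ = R_∅`. So cellwise partial credit, as a class of devices at the typed hull, reaches exactly the
`R_∅`-currency weakened Corollary (p476178 `statementUpTo_offRemainder_empty`) — not the signed floor `D = R_∅ − C`, which needs netting (THE WEIGHTED DOOR).
[cite: Mochizuki2012, IUTchIII Cor. 3.12 p. 173–174] [claim: Mochizuki2012, status: disputed] -/
theorem exists_cellCredit_weightedTrivialMass_eq_offRemainder_empty (H : BridgeHyps P) :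
    ∃ ω : Fin T.lstar × T.VQ → ℝ, (∀ c, 0 ≤ ω c) ∧ (∀ c, ω c ≤ 1) ∧
      (∀ c : Fin T.lstar × T.VQ, cellDeficit P c.1 c.2 ≤ (1 - ω c) * cellTrivialCost P c) ∧
      weightedTrivialMass P ω = offRemainder P ∅ := by
  refine ⟨fun c => if cellTrivialCost P c = 0 then (1 : ℝ) else 1 - max (cellDeficit P c.1 c.2) 0 / cellTrivialCost P c,
    fun c => ?_, fun c => ?_, fun c => ?_, ?_⟩
  · dsimp only
    by_cases ht : cellTrivialCost P c = 0
    · rw [if_pos ht]; exact zero_le_one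
    · rw [if_neg ht, sub_nonneg, div_le_one (lt_of_le_of_ne (cellTrivialCost_nonneg c) (Ne.symm ht))]
      exact max_le (cellDeficit_le_cellTrivialCost H c) (cellTrivialCost_nonneg c)
  · dsimp only
    by_cases ht : cellTrivialCost P c = 0
    · rw [if_pos ht]
    · rw [if_neg ht, sub_le_self_iff]
      exact div_nonneg (le_max_right _ _) (cellTrivialCost_nonneg c)
  · dsimp only
    rw [optimalCredit_charge_eq H c]
    exact le_max_left _ _
  · rw [offRemainder_empty_eq]
    unfold weightedTrivialMass
    exact congrArg processionNormalized (funext fun i => finsum_congr fun vQ => optimalCredit_charge_eq H (i, vQ))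

/-- **The ceiling as an `iff` on budgets**: `R_∅ ≤ B` holds iff SOME sound cell-level law `ω` (`0 ≤ ω ≤ 1`, [PC]) charges at most `B`.
[claim: Mochizuki2012, status: disputed] -/
theorem offRemainder_empty_le_iff_exists_cellCredit (H : BridgeHyps P) (B : ℝ) :
    offRemainder P ∅ ≤ B ↔ ∃ ω : Fin T.lstar × T.VQ → ℝ, (∀ c, 0 ≤ ω c) ∧ (∀ c, ω c ≤ 1) ∧
      (∀ c : Fin T.lstar × T.VQ, cellDeficit P c.1 c.2 ≤ (1 - ω c) * cellTrivialCost P c) ∧ weightedTrivialMass P ω ≤ B := by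
  constructor
  · intro hB
    obtain ⟨ω, h0, h1, hPC, heq⟩ := exists_cellCredit_weightedTrivialMass_eq_offRemainder_empty H
    exact ⟨ω, h0, h1, hPC, heq.le.trans hB⟩
  · rintro ⟨ω, -, h1, hPC, hB⟩
    exact offRemainder_empty_le_of_cellCredit_of_le H h1 hPC hB

end Summit.ABC.IUTFork.Repair.RH.SigmaLicence

end
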